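import Literature.MathematicalPhysics.QuantumLattice.HeisenbergOrderMerminWagnerGaugeProofs
import Literature.MathematicalPhysics.QuantumLattice.RectTorusInteractionBounds
import Literature.MathematicalPhysics.QuantumLattice.LocalDynamicsProofs
import Literature.MathematicalPhysics.QuantumLattice.HubbardHubbardModelKomaTasakiProofs
import HarnessLib

/-!
# Mermin–Wagner for general interactions, II: the gauge-perturbed torus Hamiltonian and the Gibbs bound

Topic `MathematicalPhysics/QuantumLattice`; second of three sibling PROOF files discharging
`Literature.MathematicalPhysics.QuantumLattice.mermin_wagner_general` of `HeisenbergOrder.lean` (see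
the module docstring of `HeisenbergOrderMerminWagnerGaugeProofs` for the route). Theorems only; no
definition, no named fact, no statement is introduced or changed.

For a Hermitian, bounded (`‖Φ X‖ ≤ C`), finite-range (`R`), rotation-invariant lattice interaction
`Φ` of quantum spins `S = n/2` on `ℤ^d` and the Hamiltonian `rectTorusHamiltonian Φ Ls` it induces on a
rectangular torus (periodic boundary conditions, `LocalDynamics.lean`):

* `sum_wrapRepSet_sum_pairs_le`: counting the wrapped terms through a pair of sites — summing a
  nonnegative pair function over the pairs of sites of every nonzero term costs at most
  `2^d 2^{(2⌊R⌋+1)^d}` times its sum over the pairs at periodic distance `≤ ⌊R⌋` (each term is a region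
  of range `⌊R⌋` through one of the `≤ 2^d` lifts of each of its sites; `RectTorusInteractionBounds`);
* `norm_hermitianPart_gauge_rectTorusHamiltonian_sub_le` (Koma–Tasaki eqs. (7), (9), (11)): for every
  real `ψ`, `‖½(W H W⁻¹ + h.c.) - H‖ ≤ K Σ_u Σ_v [dist ≤ ⌊R⌋] (cosh (m (ψ u - ψ v)) - 1)` with
  `K = ((n+1)^{k₀})² C 2^d 2^{k₀}`, `m = n k₀`, `k₀ = (2⌊R⌋+1)^d`, uniformly in the side lengths — each
  wrapped term is a charge-conserving local operator (`HigherDimLSM.commute_wrapTerm_totalSpin` from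
  rotation invariance) to which the per-term bound of file I applies;
* `norm_gibbsState_rectTorusHamiltonian_le` (eqs. (6), (10)–(12)): for a gauge eigen-operator
  `W A W⁻¹ = a A`, `|⟨A⟩_β| ≤ |a| ‖A‖ exp (β K Σ_u Σ_v [dist ≤ ⌊R⌋] (cosh (m (ψ u - ψ v)) - 1))`, from the
  model-independent trace bound `koma_tasaki_trace_bound` (`TraceInequalitiesProofs`).

## Sources

T. Koma, H. Tasaki, PRL **68** (1992) 3248 = arXiv:cond-mat/9709068, eqs. (5)–(12) and note [11];
K. R. Ito, J. Stat. Phys. **29** (1982) 747; B. Nachtergaele, R. Sims (2006) §2 and M. B. Hastings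
(2004) for the torus wrapping conventions of `LocalDynamics.lean`.
-/

noncomputable section

open Matrix Complex Finset
open scoped Matrix.Norms.L2Operator ComplexOrder

namespace Literature.MathematicalPhysics.QuantumLattice.MerminWagner

open Literature.MathematicalPhysics.QuantumLattice

variable {n : ℕ}


/-! ### The torus Hamiltonian of a finite-range interaction under the gauge -/

section Torus

open Literature.Probability.LatticeModels HigherDimLSM

variable {d : ℕ} {Ls : Fin d → ℕ} [∀ i, NeZero (Ls i)]

/-- Points of a sup-norm box neighbourhood project to torus sites at periodic distance at most the
radius. [folklore] -/
theorem torusDist_proj_le_of_mem_image_box {r : ℕ} {x y : Site d}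
    (hy : y ∈ (box d r).image (fun w => x + w)) :
    torusDist (RectTorus.proj Ls x) (RectTorus.proj Ls y) ≤ r := by
  obtain ⟨w, hw, rfl⟩ := Finset.mem_image.1 hy
  rw [mem_box] at hw
  rw [torusDist, torusNorm]
  refine Finset.sup_le fun i _ => ?_
  have hi := hw i
  have h1 : circDist (((x + w) i : ℤ) : ZMod (Ls i)) ((x i : ℤ) : ZMod (Ls i)) ≤ r := by
    rw [Pi.add_apply, Int.cast_add]
    exact (circDist_add_intCast_le _ _).trans (by omega)
  rw [circDist_comm, circDist_eq_cyclicAbs] at h1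
  exact h1


/-- **Counting the torus terms through a pair of sites.** For an interaction of range `R`, summing a
nonnegative pair function over the pairs of sites of every nonzero wrapped term costs at most
`2^d 2^{(2⌊R⌋+1)^d}` times its sum over all pairs at periodic distance `≤ ⌊R⌋` (every such term is a
region of range `⌊R⌋` through one of the `≤ 2^d` lifts of each of its sites). [folklore] -/
theorem sum_wrapRepSet_sum_pairs_le {Φ : LatticeInteraction d (n + 1)} {R : ℝ}
    (hR : Φ.HasFiniteRange R) (g : RectTorusSite Ls → RectTorusSite Ls → ℝ) (hg : ∀ u v, 0 ≤ g u v) :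
    ∑ X ∈ wrapRepSet Ls,
        (if Φ X ≠ 0 then ∑ u ∈ X.image (RectTorus.proj Ls), ∑ v ∈ X.image (RectTorus.proj Ls), g u v
          else 0) ≤
      2 ^ d * 2 ^ ((2 * ⌊R⌋₊ + 1) ^ d) * ∑ u, ∑ v, if torusDist u v ≤ ⌊R⌋₊ then g u v else 0 := by
  set h : RectTorusSite Ls → ℝ := fun u => ∑ v, if torusDist u v ≤ ⌊R⌋₊ then g u v else 0 with hh
  have hh0 : ∀ u, 0 ≤ h u := fun u => sum_nonneg fun v _ => by
    split_ifs <;> [exact hg u v; exact le_rfl]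
  -- step 1: inside a nonzero term all pairs are at periodic distance `≤ ⌊R⌋`
  have step1 : ∀ X ∈ wrapRepSet Ls,
      (if Φ X ≠ 0 then ∑ u ∈ X.image (RectTorus.proj Ls), ∑ v ∈ X.image (RectTorus.proj Ls), g u v
        else 0) ≤ ∑ u, if (Φ X ≠ 0 ∧ u ∈ X.image (RectTorus.proj Ls)) then h u else 0 := by
    intro X _
    by_cases hΦ : Φ X ≠ 0
    · rw [if_pos hΦ]
      have hin : ∑ u ∈ X.image (RectTorus.proj Ls), ∑ v ∈ X.image (RectTorus.proj Ls), g u v ≤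
          ∑ u ∈ X.image (RectTorus.proj Ls), h u := by
        refine sum_le_sum fun u hu => ?_
        obtain ⟨x, hx, rfl⟩ := Finset.mem_image.1 hu
        calc ∑ v ∈ X.image (RectTorus.proj Ls), g (RectTorus.proj Ls x) v
            = ∑ v ∈ X.image (RectTorus.proj Ls),
                (if torusDist (RectTorus.proj Ls x) v ≤ ⌊R⌋₊ then g (RectTorus.proj Ls x) v else 0) := by
              refine sum_congr rfl fun v hv => ?_
              obtain ⟨y, hy, rfl⟩ := Finset.mem_image.1 hv
              rw [if_pos (torusDist_proj_le_of_mem_image_box (hR.subset_image_box hΦ hx hy))]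
          _ ≤ h (RectTorus.proj Ls x) := by
              refine sum_le_univ_sum_of_nonneg fun v => ?_
              split_ifs <;> [exact hg _ v; exact le_rfl]
      refine hin.trans (le_of_eq ?_)
      symm
      calc ∑ u, (if (Φ X ≠ 0 ∧ u ∈ X.image (RectTorus.proj Ls)) then h u else 0)
          = ∑ u, (if u ∈ X.image (RectTorus.proj Ls) then h u else 0) := by
            refine sum_congr rfl fun u _ => ?_
            simp only [hΦ, ne_eq, not_false_eq_true, true_and]
        _ = ∑ u ∈ univ ∩ X.image (RectTorus.proj Ls), h u := sum_ite_mem _ _ _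
        _ = _ := by rw [univ_inter]
    · rw [if_neg hΦ]
      refine sum_nonneg fun u _ => ?_
      rw [if_neg (fun h' => hΦ h'.1)]
  -- step 2: the multiplicity of a site among the nonzero terms
  have step2 : ∀ u : RectTorusSite Ls,
      (((wrapRepSet Ls).filter fun X => Φ X ≠ 0 ∧ u ∈ X.image (RectTorus.proj Ls)).card : ℝ) ≤
        2 ^ d * 2 ^ ((2 * ⌊R⌋₊ + 1) ^ d) := by
    intro u
    set S := (wrapRepBox Ls).filter (fun x => RectTorus.proj Ls x = u) with hS
    set N := S.biUnion fun x => (((box d ⌊R⌋₊).image fun w => x + w).powerset) with hN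
    have hsubN : (wrapRepSet Ls).filter (fun X => Φ X ≠ 0 ∧ u ∈ X.image (RectTorus.proj Ls)) ⊆ N := by
      intro X hX
      rw [Finset.mem_filter, mem_wrapRepSet] at hX
      obtain ⟨hrep, hΦ, hu⟩ := hX
      obtain ⟨x, hx, hxu⟩ := Finset.mem_image.1 hu
      refine Finset.mem_biUnion.2 ⟨x, ?_, Finset.mem_powerset.2 (hR.subset_image_box hΦ hx)⟩
      rw [hS, Finset.mem_filter]
      exact ⟨subset_wrapRepBox Ls hrep hx, hxu⟩
    have hNcard : N.card ≤ 2 ^ d * 2 ^ ((2 * ⌊R⌋₊ + 1) ^ d) := by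
      calc N.card ≤ S.card * 2 ^ (box d ⌊R⌋₊).card := card_nbhd_le S R
        _ ≤ 2 ^ d * 2 ^ ((2 * ⌊R⌋₊ + 1) ^ d) := by
            rw [card_box]
            exact Nat.mul_le_mul_right _ (card_filter_wrapRepBox_proj_eq_le Ls u)
    exact_mod_cast (Finset.card_le_card hsubN).trans hNcard
  -- assemble
  calc _ ≤ ∑ X ∈ wrapRepSet Ls, ∑ u, if (Φ X ≠ 0 ∧ u ∈ X.image (RectTorus.proj Ls)) then h u else 0 :=
        sum_le_sum step1
    _ = ∑ u, ∑ X ∈ wrapRepSet Ls, if (Φ X ≠ 0 ∧ u ∈ X.image (RectTorus.proj Ls)) then h u else 0 :=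
        sum_comm
    _ = ∑ u, (((wrapRepSet Ls).filter fun X => Φ X ≠ 0 ∧ u ∈ X.image (RectTorus.proj Ls)).card : ℝ) *
          h u := by
        refine sum_congr rfl fun u _ => ?_
        rw [← sum_filter, sum_const, nsmul_eq_mul]
    _ ≤ ∑ u, (2 ^ d * 2 ^ ((2 * ⌊R⌋₊ + 1) ^ d) : ℝ) * h u :=
        sum_le_sum fun u _ => mul_le_mul_of_nonneg_right (step2 u) (hh0 u)
    _ = _ := by rw [← mul_sum]


omit [∀ i, NeZero (Ls i)] in
/-- Relabelling sites commutes with the adjoint. [folklore] -/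
theorem reindexOp_conjTranspose' {X : Finset (Site d)} {Y : Finset (RectTorusSite Ls)} {q : ℕ}
    (e : ↥X ≃ ↥Y) (A : Op ↥X q) : (reindexOp e A)ᴴ = reindexOp e Aᴴ := by
  ext σ τ
  simp only [conjTranspose_apply, reindexOp_apply]

/-- **The Koma–Tasaki perturbation of the torus Hamiltonian of a finite-range, bounded,
rotation-invariant interaction** (eqs. (7), (9), (11) of the source, for general quantum spin
systems as in its note [11]): for every real `ψ` on the torus,
`‖½(W H W⁻¹ + (W H W⁻¹)ᴴ) - H‖ ≤ K Σ_u Σ_v [dist(u,v) ≤ ⌊R⌋] (cosh (m (ψ u - ψ v)) - 1)` with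
`K = ((n+1)^{k₀})² C 2^d 2^{k₀}`, `m = n k₀`, `k₀ = (2⌊R⌋+1)^d`, uniformly in the side lengths.
Koma–Tasaki, PRL 68 (1992) 3248, eqs. (7), (9), (11) and note [11].
[cite: KomaTasakiPRL1992, eqs. (7), (9), (11) and note [11]] -/
theorem norm_hermitianPart_gauge_rectTorusHamiltonian_sub_le {Φ : LatticeInteraction d (n + 1)}
    {R C : ℝ} (hΦh : Φ.IsHermitian) (hΦR : Φ.HasFiniteRange R) (hΦC : Φ.IsBounded C)
    (hΦrot : Φ.IsRotationInvariant) (ψ : RectTorusSite Ls → ℝ) :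
    ‖(2 : ℂ)⁻¹ • (((Matrix.diagonal fun σ : TensorIndex _ (n + 1) =>
      ((Real.exp (-(∑ u, (ψ) u * ((σ u : ℕ) : ℝ))) : ℝ) : ℂ)) : Op (RectTorusSite Ls) (n + 1)) * rectTorusHamiltonian Φ Ls * (Matrix.diagonal fun σ : TensorIndex _ (n + 1) =>
      ((Real.exp (-(∑ u, (-ψ) u * ((σ u : ℕ) : ℝ))) : ℝ) : ℂ)) +
        (((Matrix.diagonal fun σ : TensorIndex _ (n + 1) =>
      ((Real.exp (-(∑ u, (ψ) u * ((σ u : ℕ) : ℝ))) : ℝ) : ℂ)) : Op (RectTorusSite Ls) (n + 1)) * rectTorusHamiltonian Φ Ls * (Matrix.diagonal fun σ : TensorIndex _ (n + 1) =>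
      ((Real.exp (-(∑ u, (-ψ) u * ((σ u : ℕ) : ℝ))) : ℝ) : ℂ)))ᴴ) -
        rectTorusHamiltonian Φ Ls‖ ≤
      ((n + 1 : ℝ) ^ ((2 * ⌊R⌋₊ + 1) ^ d)) ^ 2 * C * (2 ^ d * 2 ^ ((2 * ⌊R⌋₊ + 1) ^ d)) *
        ∑ u, ∑ v, if torusDist u v ≤ ⌊R⌋₊ then
          (Real.cosh (((n * (2 * ⌊R⌋₊ + 1) ^ d : ℕ) : ℝ) * (ψ u - ψ v)) - 1) else 0 := by
  set k₀ : ℕ := (2 * ⌊R⌋₊ + 1) ^ d with hk₀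
  set W : Op (RectTorusSite Ls) (n + 1) := (Matrix.diagonal fun σ : TensorIndex _ (n + 1) =>
      ((Real.exp (-(∑ u, (ψ) u * ((σ u : ℕ) : ℝ))) : ℝ) : ℂ)) with hW
  set W' : Op (RectTorusSite Ls) (n + 1) := (Matrix.diagonal fun σ : TensorIndex _ (n + 1) =>
      ((Real.exp (-(∑ u, (-ψ) u * ((σ u : ℕ) : ℝ))) : ℝ) : ℂ)) with hW'
  have hC0 : 0 ≤ C := (norm_nonneg _).trans (hΦC ∅)
  have hn1 : (1 : ℝ) ≤ n + 1 := by
    have : (0 : ℝ) ≤ n := Nat.cast_nonneg n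
    linarith
  -- the additive deviation map `M ↦ ½(W M W⁻¹ + (W M W⁻¹)ᴴ) - M`
  let F : Op (RectTorusSite Ls) (n + 1) →+ Op (RectTorusSite Ls) (n + 1) :=
    { toFun := fun M => (2 : ℂ)⁻¹ • (W * M * W' + (W * M * W')ᴴ) - M
      map_zero' := by simp
      map_add' := fun M N => by
        simp only [Matrix.mul_add, Matrix.add_mul, conjTranspose_add, smul_add]
        abel }
  have hF : ∀ M, F M = (2 : ℂ)⁻¹ • (W * M * W' + (W * M * W')ᴴ) - M := fun M => rfl
  -- the pair function
  set g : RectTorusSite Ls → RectTorusSite Ls → ℝ := fun u v =>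
    Real.cosh (n * k₀ * (ψ u - ψ v)) - 1 with hg
  have hg0 : ∀ u v, 0 ≤ g u v := fun u v => by
    simp only [hg]
    linarith [Real.one_le_cosh ((n : ℝ) * k₀ * (ψ u - ψ v))]
  -- per-term bound
  have hterm : ∀ X ∈ wrapRepSet Ls, ‖F (wrapTerm Ls X (Φ X))‖ ≤
      ((n + 1 : ℝ) ^ k₀) ^ 2 * C *
        (if Φ X ≠ 0 then ∑ u ∈ X.image (RectTorus.proj Ls), ∑ v ∈ X.image (RectTorus.proj Ls), g u v
          else 0) := by
    intro X hX
    rw [mem_wrapRepSet] at hX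
    by_cases hΦ : Φ X = 0
    · rw [hΦ, wrapTerm_zero, map_zero, norm_zero]
      simp
    rw [if_pos hΦ]
    -- the term as a local operator on `Y = proj X`
    obtain ⟨e, he⟩ := exists_equiv_image Ls X (injOn_proj_of_isWrapRepresentative hX)
    have hT : wrapTerm Ls X (Φ X) = localOp (X.image (RectTorus.proj Ls)) (reindexOp e (Φ X)) :=
      wrapTerm_eq_localOp_reindexOp Ls X e he (Φ X)
    have hBh : (reindexOp e (Φ X)).IsHermitian := by
      change (reindexOp e (Φ X))ᴴ = reindexOp e (Φ X)
      rw [reindexOp_conjTranspose', (hΦh X).eq]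
    have hBc : Commute (reindexOp e (Φ X)) (totalSpin (Λ := ↥(X.image (RectTorus.proj Ls))) n 2) := by
      have h := (commute_totalSpin_of_forall_commute_globalRotation (fun θ => hΦrot θ X) 2).map
        (reindexOp (q := n + 1) e)
      rwa [reindexOp_totalSpin] at h
    have hBC : ∀ a b, ‖reindexOp e (Φ X) a b‖ ≤ C := fun a b => by
      rw [reindexOp_apply]
      exact norm_apply_le_of_l2_opNorm_le (hΦC X) _ _
    -- the oscillation of `ψ` on `Y` is attained at a pair of sites
    have hYne : (X.image (RectTorus.proj Ls) ×ˢ X.image (RectTorus.proj Ls)).Nonempty := by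
      obtain ⟨hne, -, -⟩ := hX
      exact (hne.image _).product (hne.image _)
    obtain ⟨p, hp, hpmax⟩ := Finset.exists_max_image _ (fun p => |ψ p.1 - ψ p.2|) hYne
    obtain ⟨hp1, hp2⟩ := Finset.mem_product.1 hp
    have hκY : ∀ u ∈ X.image (RectTorus.proj Ls), ∀ v ∈ X.image (RectTorus.proj Ls),
        |ψ u - ψ v| ≤ |ψ p.1 - ψ p.2| := fun u hu v hv =>
      hpmax (u, v) (Finset.mk_mem_product hu hv)
    have hloc := norm_hermitianPart_gauge_localOp_sub_le ψ _ hBh hBc hBC hκY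
    -- sizes
    have hYcard : (X.image (RectTorus.proj Ls)).card ≤ k₀ := by
      obtain ⟨⟨x, hx⟩, -, -⟩ := hX
      calc (X.image (RectTorus.proj Ls)).card ≤ X.card := Finset.card_image_le
        _ ≤ ((box d ⌊R⌋₊).image fun w => x + w).card :=
            Finset.card_le_card (hΦR.subset_image_box hΦ hx)
        _ ≤ (box d ⌊R⌋₊).card := Finset.card_image_le
        _ = k₀ := card_box d _
    have h1 : ((n + 1 : ℝ) ^ (X.image (RectTorus.proj Ls)).card) ^ 2 ≤ ((n + 1 : ℝ) ^ k₀) ^ 2 :=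
      pow_le_pow_left₀ (by positivity) (pow_le_pow_right₀ hn1 hYcard) 2
    have hnk : (0 : ℝ) ≤ n * k₀ := by positivity
    have h2 : Real.cosh (n * (X.image (RectTorus.proj Ls)).card * |ψ p.1 - ψ p.2|) - 1 ≤
        g p.1 p.2 := by
      simp only [hg]
      rw [sub_le_sub_iff_right, ← Real.cosh_abs (↑n * ↑k₀ * (ψ p.1 - ψ p.2)), abs_mul,
        abs_of_nonneg hnk, Real.cosh_le_cosh]
      have hl : (0 : ℝ) ≤ n * (X.image (RectTorus.proj Ls)).card * |ψ p.1 - ψ p.2| := by positivity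
      have hr : (0 : ℝ) ≤ n * k₀ * |ψ p.1 - ψ p.2| := by positivity
      rw [abs_of_nonneg hl, abs_of_nonneg hr]
      refine mul_le_mul_of_nonneg_right (mul_le_mul_of_nonneg_left ?_ (Nat.cast_nonneg n))
        (abs_nonneg _)
      exact_mod_cast hYcard
    have h3 : g p.1 p.2 ≤ ∑ u ∈ X.image (RectTorus.proj Ls), ∑ v ∈ X.image (RectTorus.proj Ls), g u v :=
      calc g p.1 p.2 ≤ ∑ v ∈ X.image (RectTorus.proj Ls), g p.1 v :=
            Finset.single_le_sum (f := fun v => g p.1 v) (fun v _ => hg0 _ _) hp2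
        _ ≤ ∑ u ∈ X.image (RectTorus.proj Ls), ∑ v ∈ X.image (RectTorus.proj Ls), g u v :=
            Finset.single_le_sum (f := fun u => ∑ v ∈ X.image (RectTorus.proj Ls), g u v)
              (fun u _ => sum_nonneg fun v _ => hg0 _ _) hp1
    have hcosh0 : 0 ≤ Real.cosh (n * (X.image (RectTorus.proj Ls)).card * |ψ p.1 - ψ p.2|) - 1 := by
      linarith [Real.one_le_cosh ((n : ℝ) * (X.image (RectTorus.proj Ls)).card * |ψ p.1 - ψ p.2|)]
    rw [hF, hT]
    refine hloc.trans ?_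
    calc ((n + 1 : ℝ) ^ (X.image (RectTorus.proj Ls)).card) ^ 2 * C *
          (Real.cosh (n * (X.image (RectTorus.proj Ls)).card * |ψ p.1 - ψ p.2|) - 1)
        ≤ ((n + 1 : ℝ) ^ k₀) ^ 2 * C * g p.1 p.2 :=
          mul_le_mul (mul_le_mul_of_nonneg_right h1 hC0) h2 hcosh0 (by positivity)
      _ ≤ _ := mul_le_mul_of_nonneg_left h3 (by positivity)
  -- sum over the terms
  have hK0 : 0 ≤ ((n + 1 : ℝ) ^ k₀) ^ 2 * C := by positivity
  calc ‖(2 : ℂ)⁻¹ • (W * rectTorusHamiltonian Φ Ls * W' + (W * rectTorusHamiltonian Φ Ls * W')ᴴ) -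
        rectTorusHamiltonian Φ Ls‖
      = ‖∑ X ∈ wrapRepSet Ls, F (wrapTerm Ls X (Φ X))‖ := by
        rw [← map_sum, ← rectTorusHamiltonian_eq_sum, hF]
    _ ≤ ∑ X ∈ wrapRepSet Ls, ‖F (wrapTerm Ls X (Φ X))‖ := norm_sum_le _ _
    _ ≤ ∑ X ∈ wrapRepSet Ls, ((n + 1 : ℝ) ^ k₀) ^ 2 * C *
          (if Φ X ≠ 0 then ∑ u ∈ X.image (RectTorus.proj Ls), ∑ v ∈ X.image (RectTorus.proj Ls), g u v
            else 0) := sum_le_sum hterm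
    _ = ((n + 1 : ℝ) ^ k₀) ^ 2 * C * ∑ X ∈ wrapRepSet Ls,
          (if Φ X ≠ 0 then ∑ u ∈ X.image (RectTorus.proj Ls), ∑ v ∈ X.image (RectTorus.proj Ls), g u v
            else 0) := by rw [← mul_sum]
    _ ≤ ((n + 1 : ℝ) ^ k₀) ^ 2 * C * (2 ^ d * 2 ^ ((2 * ⌊R⌋₊ + 1) ^ d) *
          ∑ u, ∑ v, if torusDist u v ≤ ⌊R⌋₊ then g u v else 0) :=
        mul_le_mul_of_nonneg_left (sum_wrapRepSet_sum_pairs_le hΦR g hg0) hK0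
    _ = _ := by simp only [hg, hk₀]; push_cast; ring


/-- **Koma–Tasaki bound for the torus Gibbs state of a gauge eigen-operator** (eqs. (6), (10)–(12)
of the source for a general finite-range rotation-invariant spin interaction): if
`W_ψ A W_ψ⁻¹ = a A` then `|⟨A⟩_{β}| ≤ |a| ‖A‖ exp [β K Σ_u Σ_v [dist ≤ ⌊R⌋] (cosh (m (ψ u - ψ v)) - 1)]`.
Koma–Tasaki, PRL 68 (1992) 3248, eqs. (6), (10)–(12) and note [11].
[cite: KomaTasakiPRL1992, eqs. (6), (10)–(12) and note [11]] -/
theorem norm_gibbsState_rectTorusHamiltonian_le {Φ : LatticeInteraction d (n + 1)}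
    {R C : ℝ} (hΦh : Φ.IsHermitian) (hΦR : Φ.HasFiniteRange R) (hΦC : Φ.IsBounded C)
    (hΦrot : Φ.IsRotationInvariant) {β : ℝ} (hβ : 0 ≤ β) (ψ : RectTorusSite Ls → ℝ)
    (A : Op (RectTorusSite Ls) (n + 1)) (a : ℂ)
    (hA : ((Matrix.diagonal fun σ : TensorIndex _ (n + 1) =>
      ((Real.exp (-(∑ u, (ψ) u * ((σ u : ℕ) : ℝ))) : ℝ) : ℂ)) : Op (RectTorusSite Ls) (n + 1)) * A * (Matrix.diagonal fun σ : TensorIndex _ (n + 1) =>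
      ((Real.exp (-(∑ u, (-ψ) u * ((σ u : ℕ) : ℝ))) : ℝ) : ℂ)) = a • A) :
    ‖gibbsState β (rectTorusHamiltonian Φ Ls) A‖ ≤
      ‖a‖ * ‖A‖ * Real.exp (β *
        (((n + 1 : ℝ) ^ ((2 * ⌊R⌋₊ + 1) ^ d)) ^ 2 * C * (2 ^ d * 2 ^ ((2 * ⌊R⌋₊ + 1) ^ d)) *
          ∑ u, ∑ v, if torusDist u v ≤ ⌊R⌋₊ then
            (Real.cosh (((n * (2 * ⌊R⌋₊ + 1) ^ d : ℕ) : ℝ) * (ψ u - ψ v)) - 1) else 0)) := by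
  set E : ℝ := ((n + 1 : ℝ) ^ ((2 * ⌊R⌋₊ + 1) ^ d)) ^ 2 * C * (2 ^ d * 2 ^ ((2 * ⌊R⌋₊ + 1) ^ d)) *
    ∑ u, ∑ v, if torusDist u v ≤ ⌊R⌋₊ then
      (Real.cosh (((n * (2 * ⌊R⌋₊ + 1) ^ d : ℕ) : ℝ) * (ψ u - ψ v)) - 1) else 0 with hE
  set W : Op (RectTorusSite Ls) (n + 1) := (Matrix.diagonal fun σ : TensorIndex _ (n + 1) =>
      ((Real.exp (-(∑ u, (ψ) u * ((σ u : ℕ) : ℝ))) : ℝ) : ℂ)) with hW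
  set W' : Op (RectTorusSite Ls) (n + 1) := (Matrix.diagonal fun σ : TensorIndex _ (n + 1) =>
      ((Real.exp (-(∑ u, (-ψ) u * ((σ u : ℕ) : ℝ))) : ℝ) : ℂ)) with hW'
  have h1 : W * W' = 1 := gauge_mul_gauge_neg ψ
  have h2 : W' * W = 1 := gauge_neg_mul_gauge ψ
  let Gu : (Op (RectTorusSite Ls) (n + 1))ˣ := ⟨W, W', h1, h2⟩
  set H : Op (RectTorusSite Ls) (n + 1) := rectTorusHamiltonian Φ Ls with hH
  have hHh : H.IsHermitian := rectTorusHamiltonian_isHermitian' hΦh Ls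
  have hβH : ((β : ℂ) • H).IsHermitian := isHermitian_real_smul hHh β
  have key := koma_tasaki_trace_bound hβH Gu A a hA
  have hneg : -((β : ℂ) • H) = -(β : ℂ) • H := (neg_smul _ _).symm
  rw [hneg] at key
  have hdev := norm_hermitianPart_gauge_rectTorusHamiltonian_sub_le (Ls := Ls) hΦh hΦR hΦC hΦrot ψ
  rw [← hE] at hdev
  have hUn : ‖(2 : ℂ)⁻¹ • ((Gu : Op (RectTorusSite Ls) (n + 1)) * ((β : ℂ) • H) *
      ((Gu⁻¹ : (Op (RectTorusSite Ls) (n + 1))ˣ) : Op (RectTorusSite Ls) (n + 1)) +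
      ((Gu : Op (RectTorusSite Ls) (n + 1)) * ((β : ℂ) • H) *
      ((Gu⁻¹ : (Op (RectTorusSite Ls) (n + 1))ˣ) : Op (RectTorusSite Ls) (n + 1)))ᴴ) - (β : ℂ) • H‖ ≤
      β * E := by
    have hGu : (Gu : Op (RectTorusSite Ls) (n + 1)) = W := rfl
    have hGu' : ((Gu⁻¹ : (Op (RectTorusSite Ls) (n + 1))ˣ) : Op (RectTorusSite Ls) (n + 1)) = W' := rfl
    rw [hGu, hGu']
    have hs : star (β : ℂ) = β := by simp
    have hcalc : (2 : ℂ)⁻¹ • (W * ((β : ℂ) • H) * W' + (W * ((β : ℂ) • H) * W')ᴴ) - (β : ℂ) • H =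
        (β : ℂ) • ((2 : ℂ)⁻¹ • (W * H * W' + (W * H * W')ᴴ) - H) := by
      rw [Matrix.mul_smul, Matrix.smul_mul, conjTranspose_smul, hs, ← smul_add, smul_comm,
        ← smul_sub]
    rw [hcalc, norm_smul, Complex.norm_real, Real.norm_eq_abs, abs_of_nonneg hβ]
    exact mul_le_mul_of_nonneg_left hdev hβ
  have htr : 0 ≤ ((NormedSpace.exp (-(β : ℂ) • H)).trace).re := by
    rw [← hneg, Complex.re_eq_norm.mpr (posSemidef_exp_of_isHermitian hβH.neg).trace_nonneg]
    exact norm_nonneg _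
  refine norm_gibbsState_le_of_trace_bound hHh β A (key.trans ?_)
  gcongr

end Torus


end Literature.MathematicalPhysics.QuantumLattice.MerminWagner
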